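import Summits.BirchSwinnertonDyer.Rank1Residual.F1Sign2.MazurTateFittingShadowAtTwo
import Mathlib.RingTheory.Polynomial.Resultant.Basic
import HarnessLib.Audit.Tags
import HarnessLib

/-!
# Cell `bsd-f1-sign2`, IMC lens (planner-of-record `-imc` g13, MEMO-imc §10.92 / D-imc-49): the INTEGRAL KURIHARA PAIR at `p = 2` —
# P49c `KuriharaPairIndexLawAtTwo`, P49c♭ `KuriharaPairIndexLawFormal`, P49a⁺ `MazurTateLevelNormParityLawAtTwo` (WORDS-THEOREM, REF1 §144),
# P49e `MazurTateLevelZeroSelmerJumpAtTwo`, P49d `KuriharaPairSquareTypeAtTwo` (statements only; filed after REF1 §144)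

PORT (cell `bsd-f1-sign2`, seat `-ty` g13; CANDIDATES row IMC-KP2) of -imc g13's `HOME/MEMO-imc-data/dimc49/lean/SketchG13KPI.lean` (sha16 b7efce60df678e30;
MEMO-imc §10.92 D-imc-49, memo c06d80bfcf3013be l.1660; STATUS 2026-08-28T21:24:36Z; bundle `MEMO-imc-data/dimc49/` README-49 551481e7892e4fa7,
RESULTS-49 dcf934ad849828ec, SHA16SUMS c8dc791eab07edfa; census = two engines: PARI/GP `kpi49.gp` 418ff438055a4657 kit j318021 (961 curves, a₂ ∈ {0, ±2},
rank 0, N < 10⁴, 2 ≤ n ≤ 6) × python `kpi49_e2.py` (882 curves, n ≤ 3): KO 2006 Thm 0.1(2) reproduced exactly on 321 curves; a₂ = 0 block BSD₂/CT-consistent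
1 031/1 031 basic cells; L1 random towers 886/886; L2 4 275/4 275 cells).  Bodies VERBATIM from the sketch, in the sketch's order; typer edits: this
header, `import HarnessLib.Audit.Tags` (for `@[conjecture]`), the sketch's cite key for «Dai–Li 2026» → `DengLi2026` (the memo's «Dai–Li 2026, arXiv 2603.14234» is
Li-Tong DENG – Yong-Xiong LI 2026; key added to references.bib by the typer), **P49a⁺ filed as a plain `def` (REF1 §144 (b): words-proof CERTIFIED
— director ruling v4.0-add1: a REF1-certified words-theorem is a frontier-ledger entry typed as a plain `def`, never kernel currency; the other four keep
the planner's `@[conjecture]`)**, and REF1 §144 riders recorded in the docstrings.  REF1's two NEW theorem-grade riders R144-1 (level-2 unit law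
`Even a₂ ∧ 2 ∤ θ₀(0) ∧ 2-integrality ⇒ v₂(N_2) = 1`, corollary «`GoodSS W 2 ∧ N ≡ ±1 (mod 8) ⇒ 2 ∣ L(W,1)/Ω`», census 193/193) and R144-2 (even-level
rigidity `v₂(N_{2k}) = (4^k − 1)/3` on the basic locus, formal over ℤ[X]) are NOT typed here (suggested names P49f/P49g; the planner-of-record -imc g14
words them, the typer APPENDS them to this file).
REF1 §144 (refuter-bsd-f1-sign2-ref1 g13, `HOME/REF1-AUDIT-v1.md` l.2772; evidence `HOME/REF1-data/b144/` — `lean/Probe144.lean` 448406348b8d4819 farm rc 0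
(5 probe sorries), kit j318896 `formal144.gp` 02f8ecf4e6cd5041 / `curve144.gp` 84632ca9185ab576 / `kpi49_imc_verbatim.gp` 418ff438055a4657; INBOX
2026-08-28T22:07:59Z) ONE LINE verbatim: «D-imc-49-R1 DONE: REF1 §144 audit of `dimc49/lean/SketchG13KPI.lean` b7efce60df678e30 — ALL 5 Props SURVIVE,
0 killed; L2 words-proof CERTIFIED; L1 REPRODUCED independently incl. |a| ≥ 4; two NEW theorem-grade riders R144-1/R144-2» — (a) helper defs junk-free
(J1 `mtLevelNorm 0 m = 0` caught by the `≠ 0` guards; J2 `padicValRat 2 0` never reached; `mtLevelNorm` IS the exact norm `N_{ℚ(ζ_{2^m})/ℚ}(ψ_m(θ))` by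
Mathlib `resultant_eq_prod_roots_sub`; torsion of `ℤ[X] ⧸ kuriharaPairIdeal` finite since `ω_n` is monic; odd rescaling invariance correct; `IsNewformOf`
pins the level so `N % 8` is the conductor); (b) P49a⁺ THEOREM-GRADE: exact relation `conj ψ(θ_n) = w_f·ψ(N)·ψ(θ_n)` (w_f = ROOT NUMBER; sign and ±1
exponent immaterial), coset lemma in `ℚ₂(ζ_{2^n})/ℚ₂(ζ_{2^n})⁺` verified line by line, exactness checked on 11a1/19a1/57c1 at n = 2; proof route (REF2 v41 §1.1
(R-144-a), superseding REF1's «one Literature fact owed»): the finite-level functional equation with its Fricke sign is ALREADY KERNEL in the tree —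
`Literature/Barriers/BirchSwinnertonDyer/PAdicFunctionalEquationSharpFlatTwoProofs` · `exists_two_mul_mazurTateElement_fe` ([cite: MazurTateTeitelbaum1986Invent, §I.17];
sign = root number by `HeegnerPointReflectionProofs` · `rootNumber_eq_neg_frickeEigenvalue`) — a Lean proof of P49a⁺ needs that theorem evaluated at ψ_n plus
the 10-line unit-coboundary lemma in ℤ₂[ζ_{2ⁿ}], NO new Literature fact; (c) P49c♭ reproduced 6 720/6 720 tower-layers (a ∈ {0, ±2, ±4, 6, 8, −10, 12, 16}, n = 2..5) + 1 680/1 680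
(n ≤ 6), corank 1 FORCED by the typed hypotheses (paper proof), `Odd θ₀` / `θ 1 = C c * (X+2)` load-bearing; (d) P49c SURVIVES, reduction P49c ⇐ P49c♭ +
P49a⁺(n = 2) + three-term relation + Birch/root number + odd rescaling is gap-free GIVEN R144-1; (f) P49d = P49c♭ ⊕ P49a⁺ in the formal model (square
type ⟺ all v₂N_m odd, sharp 1 226/790) — same proof, not an independent conjecture; (g) P49e well-typed, scale-free, conjecture-grade (zeros ⇒ Selmer),
`j = 0` vacuous-true harmless, n = 1 = the χ₈ case.
REF2 D-imc-49-R2 (refuter-bsd-f1-sign2-ref2 g41, `HOME/REF2-PLACEMENT-v41.md` 00028fe2f0cecc0c §1; slot read §1.7 of p672838 CLEAN; REF2_TXT verbatim, folded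
by -ty g13 as text): «P49a⁺ = VARIANT of the tree's kernel PARITY(2) law `Supersingular.SignedLambdaParityTwo.even_lam_mazurTate_two_iff'` (μ-free; `Even λ(θ_n) ↔
N ≡ ±1 (mod 8)` under `λ(θ_n) + 2 ≤ 2ⁿ`) in the top-character-valuation currency: for λ(θ_n) < 2^{n−1}, `v₂N_n = 2^{n−1}μ + λ ≡ λ (mod 2)` ([cite: DengLi2026,
Lemma 4.3] = Pollack's λ-reading extended to p = 2), so the two laws coincide there; on the exceptional range λ(θ_n) ≥ 2^{n−1} (the (μ,λ)(θ_3) = (0,7) class of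
basic a₂ = 0 curves; in print only for one CM family, [cite: DengLi2026, Prop. 4.8, App. A], by mod-4 Hecke congruences) P49a⁺ is new content; proof route kernel
(`exists_two_mul_mazurTateElement_fe` + unit-coboundary lemma), no Literature fact owed; not printed as a sentence (KO 2006 Prop. 1.1/1.3, Mazur–Tate 1987 §1,
MTT 1986 §I.17, Greenberg LNM 1716 p.181 nearest); beyond-print no. R144-1 («ss at 2 ∧ N ≡ ±1 (mod 8) ⇒ 2 ∣ (a₂²−2a₂−1)L(W,1)/Ω»): not in print unconditionally
(nearest [cite: KuriharaOtsuki2006, Prop. 1.1] ⇒ Tam even, + BSD) — beyond-print-ELIGIBLE if kernel-proved. R144-2: known (q_n-growth [cite: Pollack2005, Lemma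
5.1], [cite: KuriharaOtsuki2006, Prop. 1.3], [cite: DengLi2026, Prop. 4.5, Prop. 4.8]; tree `MazurTateLayerConsistency.lam_eq_lam_add_of_mu_eq_zero_of_even`).
P49c♭: = [cite: Pollack2005, Lemma 5.2, Prop. 5.3] at p = 2 / corank 1 / hypothesis `N_m ≠ 0` (variant; -imc g14's level-exact-sequence proof is Pollack's);
[cite: KuriharaOtsuki2006, Lemma 2.3 (2), §2.2] for a₂ = ±2. P49e: conjecture-grade (zeros ⇒ Selmer = 2-adic IMC/BSD-over-ℚ_n direction; hypothesis side kernel via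
`LambdaInvariantZeroSetTwisted.ratTwistedSymbolSum_eq_zero_iff_of_mazurTate` + Birch); 27a1 ∈ ZEROS-49 is [cite: KuriharaOtsuki2006, Remark 0.2 (3)]. P49d: =
P49c♭ ⊕ P49a⁺ (REF1). Prior art for any a₂ = 0 tower claim: [cite: DengLi2026, Thm. 1.3] (CM conductor 243 and twists: rank 1 over every ℚ_n, Ш(E/ℚ_∞)(2)
infinite; v₂N_3 = 5 class).»  In print for basic a₂ = ±2: [cite: KuriharaOtsuki2006, Thm. 0.1, Prop. 1.3] (all three laws); open block a₂ = 0
([cite: KimKurihara2021, Conj. 1.6, Rem. 1.10]).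
PARTITION: none moved; beyond-print theorem: no (P49a⁺ words-certified functional-equation law, frontier-ledger entry; P49c♭ algebra target; P49c/P49d/P49e
conjecture-grade); BSD not proved; no item closed; bears_on: stmt-BirchSwinnertonDyer-23715 (supersingular-at-2 third of the cell).

## The sketch's own summary (verbatim)

# Cell `bsd-f1-sign2` — IMC lens (seat `-imc`) g13, MEMO-imc §10.92 / D-imc-49 (SKETCH — statements only, for `-ty` / `-ref1`):
# the INTEGRAL Kurihara pair at `p = 2` — `KuriharaPairIndexLawAtTwo` (P49c) and its formal core `KuriharaPairIndexLawFormal` (P49c♭),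
# `MazurTateLevelNormParityLawAtTwo` (P49a⁺), `MazurTateLevelZeroSelmerJumpAtTwo` (P49e), `KuriharaPairSquareTypeAtTwo` (P49d)

For `W/ℚ` with good supersingular reduction at `2`, newform `f`, period pin `ϖ·Ω(W) = Ω⁺_f` (AN-1), put
`θ_n := C ϖ * mazurTateElement f 2 n ∈ ℚ[X]` (`= −θ^{KO}_{ℚ_n}`, KO 2006 §1.2; `X = T = γ − 1`, degree `< 2^n`),
`Λ_n := ℤ[X]/((1+X)^{2^n} − 1)`, `ν_{n−1,n} = ` multiplication by `1 + (1+X)^{2^{n−1}}`.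
* `mtLevelNorm θ_n n := Res_X(Φ_{2^n}(1+X), θ_n) = ∏_{χ of exact order 2^n} χ(θ_n)` (`= ` a `2`-adic unit times
  `∏_{cond χ = 2^{n+2}, χ even} τ(χ) L(W, χ̄, 1)/Ω`, MTT / Deng–Li 2026 Thm 3.4 (2) [-ty: arXiv:2603.14234, key `DengLi2026`; «Dai–Li» in the memo]);
* `kuriharaPairTorsionTwoVal P Q n := v₂ #(Λ_n/(P, ν Q))_tors` for INTEGER lifts `P = D θ_n`, `Q = D θ_{n−1}`, `D` odd
  (the `2`-primary torsion is independent of the odd `D`);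
* BASIC := `2 ∤ θ_0(0)` (`θ_0 = (a₂² − 2a₂ − 1)·L(W,1)/Ω`, the prefactor is odd) and `Tam(W)` odd (KO 2006's hypotheses).
KO 2006 Thm 0.1 (a₂ = ±2, basic) PROVES `Sel(E/ℚ_n)[2^∞]^∨ ≅ Λ_n ⊗ ℤ₂/(θ_n, ν θ_{n−1})` with
`Ш(E/ℚ_n)[2^∞] ≅ ⊕_{m=3}^{n} (ℤ/2^{n−m+1})^{q_m − q_{m−1}}` and Prop 1.3 gives `v₂ N_m = q_m`; so for a₂ = ±2 all three
Props below are IN PRINT (`I_n = Σ_{m=3}^n (n−m+1)(q_m − q_{m−1}) = Σ_{m=2}^n (q_m − 1)`). The OPEN block is `a₂ = 0`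
(KO part II never appeared; Kim–Kurihara 2021 Rem 1.10). Nothing asserted; no `sorry`; no instance; no notation.
-/

open scoped Classical MatrixGroups ModularForm NumberField

open CongruenceSubgroup Polynomial WeierstrassCurve Literature.NumberTheory.EllipticCurves Literature.Barriers.BirchSwinnertonDyer
  Literature.NumberTheory.EllipticCurves.ModularForms
  Literature.NumberTheory.EllipticCurves.Rank1Residual ZpExtension

namespace Summit.BirchSwinnertonDyer.Rank1Residual.F1Sign2

/-- `N_m(P) := Res_X(Φ_{2^m}(1 + X), P)`: the product of `P(ζ − 1)` over the primitive `2^m`-th roots of unity `ζ`,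
i.e. over the characters of `Gal(ℚ_m/ℚ)` of exact order `2^m` applied to `P(γ − 1)` (`m ≥ 1`; for `m = 0` it is `P(0)`). -/
noncomputable def mtLevelNorm (P : ℚ[X]) (m : ℕ) : ℚ :=
  Polynomial.resultant ((Polynomial.cyclotomic (2 ^ m) ℚ).comp (X + 1)) P

/-- The Kurihara pair ideal `((1+X)^{2^n} − 1, P, Q·(1 + (1+X)^{2^{n−1}})) ⊆ ℤ[X]`, so that
`ℤ[X] ⧸ kuriharaPairIdeal P Q n = Λ_n/(P, ν_{n−1,n} Q)`. -/
noncomputable def kuriharaPairIdeal (P Q : ℤ[X]) (n : ℕ) : Ideal ℤ[X] :=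
  Ideal.span {((X : ℤ[X]) + 1) ^ (2 ^ n) - 1, P, Q * (1 + ((X : ℤ[X]) + 1) ^ (2 ^ (n - 1)))}

/-- `I_n(P, Q) := v₂ #(Λ_n/(P, ν Q))_tors` (the torsion subgroup of a finitely generated abelian group is finite;
`Nat.card` junk `0` never fires). -/
noncomputable def kuriharaPairTorsionTwoVal (P Q : ℤ[X]) (n : ℕ) : ℕ :=
  padicValNat 2 (Nat.card ↥(Submodule.torsion ℤ (ℤ[X] ⧸ kuriharaPairIdeal P Q n)))

/-- **P49c `KuriharaPairIndexLawAtTwo`** — candidate, conjecture-grade (D-imc-49). For `W/ℚ` globally minimal with good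
supersingular reduction at `2`, newform `f`, period pin, `θ_n` `2`-integral, BASIC (`2 ∤ θ_0(0)`, `Tam(W)` odd): for every `n ≥ 2`
such that the level norms `N_2, …, N_n` of `θ_2, …, θ_n` are non-zero, and every odd `D` with integer lifts `P = D θ_n`,
`Q = D θ_{n−1}`:  `v₂ #(Λ_n/(P, ν Q))_tors = Σ_{m=2}^{n} v₂(N_m) − (n − 1)`.
Reading: LHS = Kurihara's predicted `v₂ #Ш(W/ℚ_n)[2^∞]` (pair presentation of `Sel^∨` at `2`), RHS = the BSD₂ prediction of the same
number up the cyclotomic `ℤ₂`-tower (periods `Ω^{2^n}`, Gauss sums cancel `√d`, `Reg_n = 2^{n−1} Reg_1`, `Tam` `2`-adically stable,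
`Ш(W/ℚ_1)[2] = 0`); the Prop itself mentions neither Selmer groups nor `L`-values — it is an identity between Mazur–Tate elements.
In print for `a₂ = ±2` (KO 2006 Thm 0.1 + Prop 1.3); open for `a₂ = 0`.
REF1 §144 (d): SURVIVES; the reduction P49c ⇐ P49c♭ is gap-free with its inputs made explicit — (1) the three-term relation `ω_{m−1} ∣ θ_m − a₂θ_{m−1} +
(1+(X+1)^{2^{m−2}})θ_{m−2}` (verified exactly on 8 curves × m ≤ 5), (2) `θ_1 = c(X+2)` = the χ₈-zero, forced by the root number when `N ≡ ±3 (mod 8)`, (3) REF1's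
NEW rider R144-1 (level-2 unit law: `Even a₂ ∧ 2 ∤ θ₀(0) ∧` 2-integrality `⇒ v₂(N_2) = 1` exactly, so P49a⁺ at n = 2 gives `N ≡ ±3 (mod 8)` from THESE
hypotheses; corollary «`GoodSS W 2 ∧ N ≡ ±1 (mod 8) ⇒ 2 ∣ L(W,1)/Ω`», census 193/193), (4) Birch + odd rescaling; `¬HasCM` correctly absent; the `∀ (D, P, Q)`
is inhabited for every curve in the regime (A3).
[cite: KuriharaOtsuki2006, Thm. 0.1, Prop. 1.3, §1.2] [cite: Kurihara2002, Thm. 0.1 (odd p)] [cite: KimKurihara2021, Conj. 1.6, Rem. 1.10] -/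
@[conjecture] def KuriharaPairIndexLawAtTwo : Prop :=
  ∀ {N : ℕ} [NeZero N] (f : CuspForm (Gamma0 N) 2) (W : WeierstrassCurve ℚ) [W.IsElliptic] [W.IsGloballyMinimal]
    (ϖ : ℚ), IsNewformOf W f → GoodSS W 2 →
    (ϖ : ℝ) * W.realPeriodRat = plusPeriod f →
    (∀ n i : ℕ, 0 ≤ padicValRat 2 ((C ϖ * mazurTateElement f 2 n).coeff i)) →
    (C ϖ * mazurTateElement f 2 0).coeff 0 ≠ 0 → padicValRat 2 ((C ϖ * mazurTateElement f 2 0).coeff 0) = 0 →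
    Odd W.tamagawaProduct →
    ∀ n : ℕ, 2 ≤ n →
      (∀ m : ℕ, 2 ≤ m → m ≤ n → mtLevelNorm (C ϖ * mazurTateElement f 2 m) m ≠ 0) →
      ∀ (D : ℕ) (P Q : ℤ[X]), Odd D →
        P.map (Int.castRingHom ℚ) = C (D : ℚ) * (C ϖ * mazurTateElement f 2 n) →
        Q.map (Int.castRingHom ℚ) = C (D : ℚ) * (C ϖ * mazurTateElement f 2 (n - 1)) →
        (kuriharaPairTorsionTwoVal P Q n : ℤ) =
          (∑ m ∈ Finset.Icc 2 n, padicValRat 2 (mtLevelNorm (C ϖ * mazurTateElement f 2 m) m)) - ((n - 1 : ℕ) : ℤ)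

/-- **P49a⁺ `MazurTateLevelNormParityLawAtTwo`** — candidate, THEOREM-grade (functional-equation grade; D-imc-49 law L2).
For `W/ℚ` of conductor `N` with good supersingular reduction at `2` and newform `f` of level `N`, every `n ≥ 2` with `N_n := mtLevelNorm θ_n n ≠ 0`:
`v₂(N_n)` is ODD iff `N ≡ ±3 (mod 8)` (and EVEN iff `N ≡ ±1 (mod 8)`). No period pin / integrality / basic hypothesis is needed
(rescaling `θ_n ↦ c·θ_n` shifts `v₂(N_n)` by `2^{n−1}·v₂(c)`, even). Words-proof (memo §10.92 (L2)): `N_n = Norm_{K/ℚ₂}(ψ_n(θ_n))`,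
`K = ℚ₂(ζ_{2^n})`, so `v₂(N_n) = v_π(ψ_n(θ_n))`; the Atkin–Lehner functional equation of the Mazur–Tate element gives
`ψ̄_n(θ_n) = ± ψ_n(σ_N)^{∓1}·ψ_n(θ_n)`; since `K/K⁺` is ramified, `{c(β)/β : β ∈ K^×} ⊋ {c(u)/u : u ∈ 𝒪_K^×}` with index `2` detected by the
parity of `v_π(β)`, and `±ζ^k` lies in the unit image iff `k` is even; `ψ_n(σ_N) = ζ^{±ind₅(±N)}` has odd exponent iff `N ≡ ±3 (mod 8)`.
CENSUS (BC5 witness): D-imc-49 kit j318021, 961 curves (`a₂ ∈ {0, ±2}`, rank 0, `N < 10⁴`), `2 ≤ n ≤ 6`: 4 275 / 4 275 non-vanishing cells obey the law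
(768 curves `N ≡ ±3`: all odd; 193 curves `N ≡ ±1`: all even), 0 exceptions. In print for basic `a₂ = ±2` (`v₂ N_n = q_n` odd, KO 2006 Prop. 1.3).
**REF1 §144 (b): WORDS-THEOREM, proof CERTIFIED** — exact relation `conj ψ(θ_n) = w_f·ψ(N)·ψ(θ_n)` for the tree's convention (`σ_{5^s} ↦ (X+1)^s`, ψ even
primitive mod 2^{n+2}; `w_f` = root number — «ε» below is `w_f`, not the Fricke eigenvalue, and the exponent is `+1`; neither affects the conclusion);
coset lemma: in `K = ℚ₂(ζ_{2^n})`, `±ζ^k ∈ {c(u)/u : u ∈ 𝒪_K^×} ⟺ k even`, so `conj β = ±ζ^e β`, `β ≠ 0 ⇒ v_π(β) ≡ e (mod 2)`, `v₂(N_n) = v_π(β)`, `e odd ⟺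
N ≡ ±3 (mod 8)`; exactness checked on 11a1/19a1/57c1 (n = 2).  Lean proof route (REF2 v41 §1.1 (R-144-a)): the finite-level functional equation with its
Fricke sign is ALREADY KERNEL in the tree (`PAdicFunctionalEquationSharpFlatTwoProofs` · `exists_two_mul_mazurTateElement_fe`, [cite: MazurTateTeitelbaum1986Invent, §I.17];
sign = root number by `rootNumber_eq_neg_frickeEigenvalue`) — evaluate it at ψ_n and add the 10-line unit-coboundary lemma in ℤ₂[ζ_{2ⁿ}]; NO new Literature fact.  Filed as a plain `def` (director ruling v4.0-add1: REF1-certified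
words-theorem = frontier-ledger entry; the planner's sketch had `@[conjecture]`).  Cite note (-ty): the memo's «Dai–Li 2026» = Deng–Li 2026, arXiv:2603.14234.
[cite: KuriharaOtsuki2006, Prop. 1.3, §1.2] [cite: MazurTate1987, (functional equation of modular elements)] [cite: DengLi2026, Thm. 3.4 (2)] -/
def MazurTateLevelNormParityLawAtTwo : Prop :=
  ∀ {N : ℕ} [NeZero N] (f : CuspForm (Gamma0 N) 2) (W : WeierstrassCurve ℚ) [W.IsElliptic] [W.IsGloballyMinimal],
    IsNewformOf W f → GoodSS W 2 →
    ∀ n : ℕ, 2 ≤ n → mtLevelNorm (mazurTateElement f 2 n) n ≠ 0 →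
      (Odd (padicValRat 2 (mtLevelNorm (mazurTateElement f 2 n) n)) ↔ (N % 8 = 3 ∨ N % 8 = 5))

/-- **P49c♭ `KuriharaPairIndexLawFormal`** — candidate, THEOREM-grade (pure commutative algebra; D-imc-49 law L1).
For an even integer `a`, an odd constant `θ_0`, `θ_1 = c·(X + 2)` (level-1 value zero), and polynomials `θ_2, …, θ_n ∈ ℤ[X]` satisfying the
three-term distribution relations `θ_m ≡ a·θ_{m−1} − (1 + (1+X)^{2^{m−2}})·θ_{m−2} (mod (1+X)^{2^{m−1}} − 1)` (`2 ≤ m ≤ n`) with non-zero level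
norms `N_2, …, N_n`: `v₂ #(ℤ[X]/((1+X)^{2^n} − 1, θ_n, (1 + (1+X)^{2^{n−1}}) θ_{n−1}))_tors = Σ_{m=2}^n v₂(N_m) − (n − 1)`.
So the «index law» P49c is an IDENTITY of `Λ_n`, not arithmetic: Kurihara's pair presentation of `Sel(E/ℚ_n)[2^∞]^∨` implies the BSD₂ order formula up the
tower automatically, and conversely the modular symbols cannot contradict BSD₂ orders. CENSUS: 961 curves × `n ≤ 6` (j318021: every basic cell, 0 exceptions) and
`> 900` random towers (`a ∈ {0, ±2}`, `n ≤ 4`; offset `min(v₂ θ_0, v₂ c)` when `θ_0` is not odd).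
REF1 §144 (c): SURVIVES (theorem-grade algebra target); REPRODUCED by an independent X-basis PARI engine (`formal144.gp`, kit j318896) on the FULL `Even a`
range — 6 720/6 720 tower-layers (a ∈ {0, ±2, ±4, 6, 8, −10, 12, 16}, n = 2..5; 4 032/4 032 at |a| ≥ 4) + 1 680/1 680 (n ≤ 6); corank 1 is FORCED by the typed
hypotheses (paper proof: the level-1 character kills the pair, no two consecutive `c_j = a c_{j−1} − 2 c_{j−2}` vanish); `Odd θ₀` and `θ 1 = C c * (X + 2)`
load-bearing (mutation changes the law).  -imc g14 (21:53Z) announces a paper proof in general form (level exact sequence, corank offset) — not yet REF1-certified;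
kept `@[conjecture]` as in the sketch until then.  REF2 v41 §1.7 (β): = Pollack 2005 Lemma 5.2 + Prop. 5.3 (level exact sequence
`0 → Λ_{n−1}/J_{n−1} →ν Λ_n/J_n → 𝒪_n/(ψ_n θ_n) → 0`, odd p, corank 0) transposed to p = 2, corank 1 (offset −(n−1): ν = ×2 on the trivial-character line,
KO 2006 §2.2 / Lemma 2.3 (2)); Pollack's hypothesis «μ = 0 ∧ λ < p^{n−1}» is used only for ψ_n(θ_n) ≠ 0 = the typed `N_m ≠ 0` [cite: Pollack2005, Lemma 5.2, Prop. 5.3].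
[cite: KuriharaOtsuki2006, Thm. 0.1 (shape of the presentation)]
[cite: Kurihara2002, Thm. 0.1 (odd p)] -/
@[conjecture] def KuriharaPairIndexLawFormal : Prop :=
  ∀ (a c θ₀ : ℤ) (θ : ℕ → ℤ[X]) (n : ℕ), 2 ≤ n → Even a → Odd θ₀ →
    θ 0 = C θ₀ → θ 1 = C c * (X + 2) →
    (∀ m : ℕ, 2 ≤ m → m ≤ n →
      (((X : ℤ[X]) + 1) ^ (2 ^ (m - 1)) - 1) ∣ (θ m - C a * θ (m - 1) + (1 + ((X : ℤ[X]) + 1) ^ (2 ^ (m - 2))) * θ (m - 2))) →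
    (∀ m : ℕ, 2 ≤ m → m ≤ n → mtLevelNorm ((θ m).map (Int.castRingHom ℚ)) m ≠ 0) →
    (kuriharaPairTorsionTwoVal (θ n) (θ (n - 1)) n : ℤ) =
      (∑ m ∈ Finset.Icc 2 n, padicValRat 2 (mtLevelNorm ((θ m).map (Int.castRingHom ℚ)) m)) - ((n - 1 : ℕ) : ℤ)

/-- **P49e `MazurTateLevelZeroSelmerJumpAtTwo`** — candidate, conjecture-grade (IMC-at-2 / BSD consequence; D-imc-49 exceptional zeros).
If the level-`n` norm of the Mazur–Tate element vanishes (all `2^{n−1}` conjugate twisted values `L(W, ψ, 1)`, `ψ` of exact order `2^n` and conductor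
`2^{n+2}`, vanish), then `Sel_{2^∞}(W/ℚ_n)` contains `(ℤ/2^j)^{2^{n−1}}` for every `j` (corank `≥ 2^{n−1}` from level `n` alone).
The «zeros ⇒ Selmer classes» direction for even Dirichlet twists of `2`-power order: open (no Heegner/Euler-system construction; `ψ` is not self-dual so
parity gives nothing); implied by the `2`-adic main conjecture for `W` (supersingular `2`: Sprung's ♯/♭ form, open at `p = 2`) via control, or by BSD over `ℚ_n`.
CENSUS (j318021 + g6 §10.57 (A) exact twisted values, two engines): level-3 zeros for 35/305 basic `a₂ = 0` curves (27a1, 35a1, 37b1, 189c1, 315a1, 323a1, …;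
all in the class `(μ,λ)(θ_3) = (0,7)`, 35/79 of it), 0/321 basic `a₂ = ±2` (KO: `v₂ N_3 = 3`), 10 non-basic; level-2 zeros for 26 non-basic curves.
CHEAPEST FALSIFIER (run): `dim Sel₂(W/ℚ_n) ≥ 2^{n−1}` on g6's D-imc-17 descents — 22/22 level-3-zero curves have `s_3 ∈ {5,6,7}` ≥ 4, 23/23 level-2-zero curves
have `s_2 ≥ 3` ≥ 2: survives (weakly).  REF1 §144 (g): well-typed, scale-free, conjecture-grade (zeros ⇒ Selmer direction); `j = 0` vacuous-true (harmless),
`n = 1` = the χ₈ case; on the basic locus P49e fires only at ODD n (R144-2: even-level rigidity `v₂(N_{2k}) = (4^k − 1)/3`, so `N_{2k} ≠ 0`).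
[cite: MazurTate1987, Conj. 1 («weak vanishing»)] [cite: Sprung2017, p. 7] [cite: Kato2004, Thm. 17.4 (upper bound direction only)] -/
@[conjecture] def MazurTateLevelZeroSelmerJumpAtTwo : Prop :=
  ∀ {N : ℕ} [NeZero N] (f : CuspForm (Gamma0 N) 2) (W : WeierstrassCurve ℚ) [W.IsElliptic] [W.IsGloballyMinimal],
    IsNewformOf W f → GoodSS W 2 →
    ∀ (κ : ZpExtension ℚ 2), κ.IsCyclotomic →
    ∀ n : ℕ, 1 ≤ n → mtLevelNorm (mazurTateElement f 2 n) n = 0 →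
      ∀ j : ℕ, nRankAtLeast (↥(W.selmerLayer κ n)) (2 ^ j) (2 ^ (n - 1))

/-- **P49d `KuriharaPairSquareTypeAtTwo`** — candidate, conjecture-grade (D-imc-49): on the same locus the torsion of the pair
quotient is of SQUARE TYPE, `(Λ_n/(P, ν Q))_tors[2^∞] ≅ B × B` — what Cassels–Tate forces on `Ш(W/ℚ_n)[2^∞]` if Kurihara's pair
presents `Sel^∨` at `2`. (Encoded as
`tors[2^∞] ≃+ B × B`, `tors[2^∞]` = the torsion by the submonoid of powers of `2`.) In print for `a₂ = ±2` (multiplicities `q_m − q_{m−1}` even).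
REF1 §144 (f): SURVIVES; in the formal model square type ⟺ all `v₂ N_m` odd, SHARP (n = 3, 4: 1 226/1 226 all-odd square, 790/790 some-even non-square)
⇒ P49d = P49c♭ ⊕ P49a⁺ — same proof, NOT an independent conjecture. [cite: KuriharaOtsuki2006, Thm. 0.1] -/
@[conjecture] def KuriharaPairSquareTypeAtTwo : Prop :=
  ∀ {N : ℕ} [NeZero N] (f : CuspForm (Gamma0 N) 2) (W : WeierstrassCurve ℚ) [W.IsElliptic] [W.IsGloballyMinimal]
    (ϖ : ℚ), IsNewformOf W f → GoodSS W 2 →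
    (ϖ : ℝ) * W.realPeriodRat = plusPeriod f →
    (∀ n i : ℕ, 0 ≤ padicValRat 2 ((C ϖ * mazurTateElement f 2 n).coeff i)) →
    (C ϖ * mazurTateElement f 2 0).coeff 0 ≠ 0 → padicValRat 2 ((C ϖ * mazurTateElement f 2 0).coeff 0) = 0 →
    Odd W.tamagawaProduct →
    ∀ n : ℕ, 2 ≤ n →
      (∀ m : ℕ, 2 ≤ m → m ≤ n → mtLevelNorm (C ϖ * mazurTateElement f 2 m) m ≠ 0) →
      ∀ (D : ℕ) (P Q : ℤ[X]), Odd D →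
        P.map (Int.castRingHom ℚ) = C (D : ℚ) * (C ϖ * mazurTateElement f 2 n) →
        Q.map (Int.castRingHom ℚ) = C (D : ℚ) * (C ϖ * mazurTateElement f 2 (n - 1)) →
        ∃ (B : Type) (_ : AddCommGroup B),
          Nonempty (↥(Submodule.torsion' ℤ (ℤ[X] ⧸ kuriharaPairIdeal P Q n) (Submonoid.powers (2 : ℤ))) ≃+ B × B)

end Summit.BirchSwinnertonDyer.Rank1Residual.F1Sign2
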